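import Literature.NumberTheory.Rogawski1990.ArchTopFormWallBlockMassOfLieIntegral   -- ★ p844731 (this seat): `diagonal_map_embedding_eq_diagonal_re`, the (cpt) assembler
import HarnessLib

/-!
# The two block-mass TOKENS `hm₂`, `hm₁` of the U4-discharge junction ★ `archTopFormWallCompatible_of_blockMasses_of_clause` (A-p19 (g24) p844714) FROM THE WINDOW-FREE
# MASS FORMULA ((U) road, U4-DISCHARGE (cpt) half, LEAD F0P3a-plan (g10) WORD T9-40 (d2); Rogawski 1990 §1.7 p. 6)

Topic `NumberTheory/Rogawski1990`; namespace `Literature.NumberTheory.Rogawski1990`.  THEOREMS ONLY (no `def`, no instance, no notation, no axiom, no named fact, no `sorry`).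
Cell `pub/hodgecm-mathlib`, crux H413 = `stmt-HodgeConjecture-24833` (supports only).  Count-neutral.  HONEST LABEL: HC_CM is proved only modulo the printed citations until rung 0
closes.  The owner's junction (★ p844714, Summits-side) takes `V₂ V₁` and the tokens (W1a) `hm₂ : ∀ w b …, 0 < re σb₀·re σb₁ → archLocalTopFormHaar L 2 (diagonal b) w univ = V₂`,
(W1b) `hm₁ : ∀ w x …, archLocalTopFormHaar L 1 (diagonal ![x]) w univ = V₁` (+ the (nc) clause); this file PRODUCES (W1a), (W1b) in exactly those shapes from the window-free mass
formula (ii) «`localTopFormHaar N Jw univ = ∫⁻_{cayleySourceC} w₀ dλ`» (A-p06 (g29)) and the reference values `V₂ = ∫_{source(1₂)} w₀ dλ`, `V₁ = ∫_{source(1₁)} w₀ dλ`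
(A-p12 (g20): `V₁ = π` ★-to-be), by ★ FILE 3 `localTopFormHaar_univ_eq_of_definite_diagonal_of_mass` (congruence transport on the Lie algebra).

* **`archLocalTopFormHaar_two_diagonal_univ_eq_of_mass`** — token (W1a); **`archLocalTopFormHaar_one_diagonal_univ_eq_of_mass`** — token (W1b).

## References
* [Rogawski1990] J. D. Rogawski, *Automorphic Representations of Unitary Groups in Three Variables*, Ann. of Math. Stud. 123 (1990), §1.7 p. 6; §8.2 p. 119.
* [Macdonald1980] I. G. Macdonald, *The volume of a compact Lie group*, Invent. Math. 56 (1980), p. 93.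
-/

set_option autoImplicit false
set_option backward.isDefEq.respectTransparency false

noncomputable section

open MeasureTheory Measure Set Filter Topology NumberField NumberField.InfinitePlace NumberField.mixedEmbedding Matrix Equiv
open Literature.MeasureTheory.Group Literature.NumberTheory.Automorphic Literature.NumberTheory.Automorphic.UnitaryGroup
open Literature.NumberTheory.Weil1964 Literature.NumberTheory.Weil1964.UnitaryArchTopForm Literature.NumberTheory.Weil1964.UnitaryArchLocalTopForm
open scoped ENNReal NNReal Classical Matrix MatrixGroups Matrix.Norms.Operator ContDiff ComplexConjugate

namespace Literature.NumberTheory.Rogawski1990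

/-- Masses along an equality of carriers. [folklore] -/
private theorem localTopFormHaar_univ_congr' {n : ℕ} [MeasurableSpace (GL (Fin n) ℂ)] [BorelSpace (GL (Fin n) ℂ)] {J J' : Matrix (Fin n) (Fin n) ℂ} (h : J = J') :
    localTopFormHaar n J Set.univ = localTopFormHaar n J' Set.univ := by
  subst h; rfl

/-- A real diagonal complex matrix is hermitian. [folklore] -/
private theorem conjTranspose_diagonal_ofReal' {n : ℕ} (d : Fin n → ℝ) : (Matrix.diagonal fun i => ((d i : ℝ) : ℂ))ᴴ = Matrix.diagonal fun i => ((d i : ℝ) : ℂ) := by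
  rw [Matrix.diagonal_conjTranspose]
  congr 1; funext i; exact Complex.conj_ofReal _

/-- A real diagonal complex matrix with non-zero entries is invertible. [folklore] -/
private theorem isUnit_det_diagonal_ofReal' {n : ℕ} (d : Fin n → ℝ) (hd : ∀ i, d i ≠ 0) : IsUnit (Matrix.diagonal fun i => ((d i : ℝ) : ℂ)).det := by
  rw [Matrix.det_diagonal, isUnit_iff_ne_zero, Finset.prod_ne_zero_iff]
  exact fun i _ => Complex.ofReal_ne_zero.2 (hd i)

variable (L : Type) [Field L] [NumberField L] [IsCMField L]

/-- **TOKEN (W1a): ONE RANK-2 COMPACT TOP-FORM MASS.**  Given the window-free mass formula (ii) at `N = 2` and the reference value `V₂ = ∫_{source(1₂)} w₀ dλ`, EVERY definite real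
diagonal `2`-carrier `diag b` at EVERY complex place has `archLocalTopFormHaar L 2 (diagonal b) w (univ) = V₂` — the binder `hm₂` of ★ `archTopFormWallCompatible_of_blockMasses_of_clause`
verbatim. [cite: Rogawski1990, §1.7 p. 6] [cite: Macdonald1980, p. 93] -/
theorem archLocalTopFormHaar_two_diagonal_univ_eq_of_mass
    (hmass2 : ∀ (Jw : Matrix (Fin 2) (Fin 2) ℂ) [MeasurableSpace (GL (Fin 2) ℂ)] [BorelSpace (GL (Fin 2) ℂ)] [MeasurableSpace (skewC 2 Jw)] [BorelSpace (skewC 2 Jw)],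
      Jwᴴ = Jw → IsUnit Jw.det → localTopFormHaar 2 Jw Set.univ = ∫⁻ X in cayleySourceC 2 Jw, ENNReal.ofReal (cayleyWeightC 2 Jw X) ∂(lieStdLebesgueC 2 Jw))
    [MeasurableSpace (skewC 2 (Matrix.diagonal fun _ : Fin 2 => ((1 : ℝ) : ℂ)))] [BorelSpace (skewC 2 (Matrix.diagonal fun _ : Fin 2 => ((1 : ℝ) : ℂ)))]
    {V₂ : ℝ≥0} (hV₂ : ∫⁻ X in cayleySourceC 2 (Matrix.diagonal fun _ : Fin 2 => ((1 : ℝ) : ℂ)), ENNReal.ofReal (cayleyWeightC 2 _ X) ∂(lieStdLebesgueC 2 _) = V₂) :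
    ∀ [MeasurableSpace (GL (Fin 2) ℂ)] [BorelSpace (GL (Fin 2) ℂ)] (w : {w : InfinitePlace L // IsComplex w}) (b : Fin 2 → L) (_hb : ∀ i, b i ≠ 0)
      (_hbr : ∀ i, (IsCMField.complexConj L (b i) : L) = b i), 0 < (w.1.embedding (b 0)).re * (w.1.embedding (b 1)).re →
      archLocalTopFormHaar L 2 (Matrix.diagonal b) w Set.univ = V₂ := by
  intro _ _ w b hb hbr hs
  set d : Fin 2 → ℝ := fun i => (w.1.embedding (b i)).re with hd
  have hJ : (Matrix.diagonal b).map w.1.embedding = Matrix.diagonal fun i => ((d i : ℝ) : ℂ) := diagonal_map_embedding_eq_diagonal_re L w b hbr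
  have hsd : (∀ i, 0 < d i) ∨ (∀ i, d i < 0) := by
    rcases mul_pos_iff.1 hs with ⟨h0, h1⟩ | ⟨h0, h1⟩
    · left
      intro i; fin_cases i
      · simpa [hd] using h0
      · simpa [hd] using h1
    · right
      intro i; fin_cases i
      · simpa [hd] using h0
      · simpa [hd] using h1
  letI iM : MeasurableSpace (skewC 2 (Matrix.diagonal fun i => ((d i : ℝ) : ℂ))) := borel _
  haveI iB : BorelSpace (skewC 2 (Matrix.diagonal fun i => ((d i : ℝ) : ℂ))) := ⟨rfl⟩
  have hm := hmass2 (Matrix.diagonal fun i => ((d i : ℝ) : ℂ)) (conjTranspose_diagonal_ofReal' d)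
    (isUnit_det_diagonal_ofReal' d fun i => by rcases hsd with h | h <;> [exact (h i).ne'; exact (h i).ne])
  have hmr := hmass2 (Matrix.diagonal fun _ : Fin 2 => ((1 : ℝ) : ℂ)) (conjTranspose_diagonal_ofReal' _) (isUnit_det_diagonal_ofReal' _ fun _ => one_ne_zero)
  change localTopFormHaar 2 ((Matrix.diagonal b).map w.1.embedding) Set.univ = V₂
  rw [localTopFormHaar_univ_congr' hJ, localTopFormHaar_univ_eq_of_definite_diagonal_of_mass d (fun _ => (1 : ℝ)) hsd (Or.inl fun _ => one_pos) hm hmr, hmr, hV₂]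

/-- **TOKEN (W1b): ONE RANK-1 TOP-FORM MASS.**  Given (ii) at `N = 1` and `V₁ = ∫_{source(1₁)} w₀ dλ` (★-to-be `= π`, A-p12 (g20)), every real non-zero `1`-carrier `(x)` at every
complex place has `archLocalTopFormHaar L 1 (diagonal ![x]) w (univ) = V₁` — the binder `hm₁` verbatim. [cite: Rogawski1990, §1.7 p. 6] [cite: Macdonald1980, p. 93] -/
theorem archLocalTopFormHaar_one_diagonal_univ_eq_of_mass
    (hmass1 : ∀ (Jw : Matrix (Fin 1) (Fin 1) ℂ) [MeasurableSpace (GL (Fin 1) ℂ)] [BorelSpace (GL (Fin 1) ℂ)] [MeasurableSpace (skewC 1 Jw)] [BorelSpace (skewC 1 Jw)],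
      Jwᴴ = Jw → IsUnit Jw.det → localTopFormHaar 1 Jw Set.univ = ∫⁻ X in cayleySourceC 1 Jw, ENNReal.ofReal (cayleyWeightC 1 Jw X) ∂(lieStdLebesgueC 1 Jw))
    [MeasurableSpace (skewC 1 (Matrix.diagonal fun _ : Fin 1 => ((1 : ℝ) : ℂ)))] [BorelSpace (skewC 1 (Matrix.diagonal fun _ : Fin 1 => ((1 : ℝ) : ℂ)))]
    {V₁ : ℝ≥0} (hV₁ : ∫⁻ X in cayleySourceC 1 (Matrix.diagonal fun _ : Fin 1 => ((1 : ℝ) : ℂ)), ENNReal.ofReal (cayleyWeightC 1 _ X) ∂(lieStdLebesgueC 1 _) = V₁) :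
    ∀ [MeasurableSpace (GL (Fin 1) ℂ)] [BorelSpace (GL (Fin 1) ℂ)] (w : {w : InfinitePlace L // IsComplex w}) (x : L) (_hx : x ≠ 0) (_hxr : (IsCMField.complexConj L x : L) = x),
      archLocalTopFormHaar L 1 (Matrix.diagonal ![x]) w Set.univ = V₁ := by
  intro _ _ w x hx hxr
  set d : Fin 1 → ℝ := fun i => (w.1.embedding (![x] i)).re with hd
  have hreal : (w.1.embedding x).im = 0 := UnitaryGroup.im_embedding_eq_zero_of_complexConj_eq L w hxr
  have hJ : (Matrix.diagonal ![x]).map w.1.embedding = Matrix.diagonal fun i => ((d i : ℝ) : ℂ) :=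
    diagonal_map_embedding_eq_diagonal_re L w ![x] (fun i => by fin_cases i; simpa using hxr)
  have hre : (w.1.embedding x).re ≠ 0 := by
    intro h0
    apply hx
    have : w.1.embedding x = 0 := Complex.ext h0 hreal
    exact (map_eq_zero _).1 this
  have hsd : (∀ i, 0 < d i) ∨ (∀ i, d i < 0) := by
    rcases lt_or_gt_of_ne hre with hneg | hpos
    · right; intro i; fin_cases i; simpa [hd] using hneg
    · left; intro i; fin_cases i; simpa [hd] using hpos
  letI iM : MeasurableSpace (skewC 1 (Matrix.diagonal fun i => ((d i : ℝ) : ℂ))) := borel _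
  haveI iB : BorelSpace (skewC 1 (Matrix.diagonal fun i => ((d i : ℝ) : ℂ))) := ⟨rfl⟩
  have hm := hmass1 (Matrix.diagonal fun i => ((d i : ℝ) : ℂ)) (conjTranspose_diagonal_ofReal' d)
    (isUnit_det_diagonal_ofReal' d fun i => by rcases hsd with h | h <;> [exact (h i).ne'; exact (h i).ne])
  have hmr := hmass1 (Matrix.diagonal fun _ : Fin 1 => ((1 : ℝ) : ℂ)) (conjTranspose_diagonal_ofReal' _) (isUnit_det_diagonal_ofReal' _ fun _ => one_ne_zero)
  change localTopFormHaar 1 ((Matrix.diagonal ![x]).map w.1.embedding) Set.univ = V₁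
  rw [localTopFormHaar_univ_congr' hJ, localTopFormHaar_univ_eq_of_definite_diagonal_of_mass d (fun _ => (1 : ℝ)) hsd (Or.inl fun _ => one_pos) hm hmr, hmr, hV₁]

end Literature.NumberTheory.Rogawski1990

end
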